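import Summits.BirchSwinnertonDyer.Rank1Residual.X11b.KolyvaginHlocConcrete
import Summits.BirchSwinnertonDyer.Rank1Residual.X11b.RingClassFieldNoTorsionOfIrreducible
import Summits.BirchSwinnertonDyer.Rank1Residual.X11b.Three.HeegnerDiscriminantBound
import Literature.NumberTheory.GaloisRepresentations.DecomposedGenericInfinite
import Literature.NumberTheory.EllipticCurves.WeilPairingProofs
import HarnessLib

/-!
# The concrete `hloc` clause AT `p = 3` (`3 ∣ N`): Gross 1991 Prop. 6.2 (1) at `v ∤ m` for the
# concrete classes `c_M(m) = (d m).kolyvaginClass`, `hD` discharged, `hA` supplied on both image cells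
# — the x11b3-side COMPOSITION (team N8/O2, seat x11b3-p8 GEN 11, lead GEN 10 R11-10)

Summit-side THEOREM-ONLY file (no definition, no named fact, no `sorry`); `K : Type`.  Cell
`b2b-bsdres`, team x11b3, leaf (A′) register (R11-4 / R11-6), clause (e) `hloc`: composition home of
the concrete chain at `p = 3` (as `Three/KolyvaginH44AtThree` is for clause (f) `h44`).

HONEST FRAMING (cell `b2b-bsdres`, verbatim): this cell deletes COMBINATION-shaped residual classes
from published theorems only; the CONSTRUCTION-shaped remainder is typed, not attempted; census output
is EVIDENCE, never a Literature fact; `X11 ∧ r = 1 ∧ p = 3` stays CONSTRUCTION-SHAPED; O2 OPEN / N8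
CONSTRUCTION; this is not "finishing BSD".  HONEST FRAMING (H47 lineage, binding, this file):
**plumbing at concrete currency** — the three ENDs below compose x11b3-p2's landed concrete END
`KolyvaginHloc.hloc_concrete_of_GZ31` (`X11b/KolyvaginHlocConcrete`, p299176) at `p := 3`; on ALL of
X11b @ 3 (both image cells) the clause (e) `hloc` of leaf (A′) for the concrete classes is thereby a
tree theorem CONDITIONAL on [GZ86, III (3.1)] in its printed per-point form (the labelled binder `hGZ`,
cite-only, NOT a Literature fact) + `hcop` + one image binder + structural data; `hD : d_K < -4` is
RECOVERED from `hND` + `3 ∣ N` + the orientation; `JET@p∣N`, (γ), `h37` / `h44` / `hpoints` on the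
residual map, (A′-53) (Gross Prop. 5.3 at conductor `m > 1`), (A′-glob), (R)_M are NOT discharged; the
finiteness theorem also carries `hexc` + `hK1`; the node `Three.HsiehDescentAt₃` and the open content (t)
are unchanged; nothing is booked; no mark / label / count / tier moves.

## The composition (three theorems)

* `Three.hloc_concrete_at_three_of_GZ31` — p2's END at `p := 3`, `hp := Nat.prime_three`, with
  `hD := Three.discr_lt_neg_four_of_isCoprime_of_dvd_sq_sub hK hND h3 (d n dvd_rfl).dvd_sq_sub`
  (`X11b/Three/HeegnerDiscriminantBound`: at `3 ∣ N`, `(N, d_K) = 1` and `β² ≡ d_K (mod 4N)` force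
  `d_K ≡ 1 (mod 3)`, so `d_K ∉ {-3, -4}`); the ONLY new binder is `h3 : 3 ∣ N` (replacing `hD`); every
  other binder VERBATIM in p2's order (`hK ι hM Dt hND h3 hn hKol d hcop hGZ hA`); remaining labelled
  binders EXACTLY {`hGZ`} + `hcop` + `hA`.
* `Three.hloc_concrete_at_three_of_GZ31_of_surj_three` — `hA` REPLACED by the class-record binder
  `Surj W 3`, supplied by x11b3-p3's `RingClassNoTorsion.isAdmissible_pointsSubgroup_of_dvd`
  (`X11b/RingClassFieldNoTorsion`; Gross Lemma 4.3 / McCallum (5) from surjectivity); remaining EXACTLY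
  {`hGZ`} + `hcop` + `Surj W 3`.
* `Three.hloc_concrete_at_three_of_GZ31_of_irreducible` — `hA` REPLACED by the class-record binder
  `W.HasIrreducibleModPGaloisRep 3`, supplied by x11b3-p4's
  `NoTorsionIrr.isAdmissible_pointsSubgroup_of_hasIrreducibleModPGaloisRep_of_dvd`
  (`X11b/RingClassFieldNoTorsionOfIrreducible`; Lemma 4.3 WITHOUT surjectivity: irreducibility + Weil
  pairing + `3` unramified in `K` + `3 ∤ n`), its side inputs DISCHARGED in-file: the Weil pairing by
  the tree's theorem `WeierstrassCurve.exists_weilPairing_holds` (`Literature/…/WeilPairingProofs`),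
  `3` unramified in `K` from `3 ∤ d_K` (`hND` + `h3`; Mathlib `NumberField.not_dvd_discr_iff_isUnramifiedIn`
  + the tree's `isUnramifiedIn_of_isUnramifiedIn_span`, route (α) of x11b3-p2 GEN 9 / R10-62 (2)),
  `3 ∤ n` from the Kolyvagin-prime clause `q ≠ 3`; remaining EXACTLY {`hGZ`} + `hcop` +
  `HasIrreducibleModPGaloisRep 3`.

## References
* [GrossLMS1991] B. H. Gross, *Kolyvagin's work on modular elliptic curves*, LMS LNS 153 (1991), §1
  ("we assume that `D ≠ 3, 4`"), §3 (3.1)–(3.3), Lemma 4.3, §4 (4.1)–(4.2), Prop. 6.2 (1) and proof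
  (held `book:editornd-l-functions-arithmetic`, chunks 216–222).
* [McCallumLMS1991] W. G. McCallum, *Kolyvagin's work on Shafarevich–Tate groups*, same volume, §4
  (4)–(6), Lemma 4.3.
* [GrossZagier1986] B. H. Gross, D. Zagier, *Heegner points and derivatives of L-series*, Invent.
  Math. 84 (1986), III (3.1) (cite-only; the hypothesis `hGZ`).

## Mathlib / tree search
Tree: `KolyvaginHloc.hloc_concrete_of_GZ31[_of_surj]` (p299176); `Three.discr_lt_neg_four_of_isCoprime_of_dvd_sq_sub`
(p292135); `RingClassNoTorsion.isAdmissible_pointsSubgroup_of_dvd` (p293267);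
`NoTorsionIrr.isAdmissible_pointsSubgroup_of_hasIrreducibleModPGaloisRep_of_dvd` (p296025);
`WeierstrassCurve.exists_weilPairing_holds`; `isUnramifiedIn_of_isUnramifiedIn_span`.  Mathlib:
`NumberField.not_dvd_discr_iff_isUnramifiedIn`, `IsCoprime.isUnit_of_dvd'`.  `lean search
'hloc_concrete_at_three'` → no matches (INTENT-grep).
-/

noncomputable section

open scoped Classical
open WeierstrassCurve Field NumberField IsDedekindDomain Finset
open Literature.NumberTheory.EllipticCurves Literature.NumberTheory.GaloisRepresentations
open Literature.NumberTheory.EllipticCurves.KolyvaginCocycle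
open Literature.NumberTheory.EllipticCurves.RingClassField
open Literature.NumberTheory.EllipticCurves.ModularForms

namespace Summit.BirchSwinnertonDyer.Rank1Residual.X11b.Three

variable {K : Type} [Field K] [NumberField K] {N : ℕ} {W : WeierstrassCurve ℚ}

/-- **Gross 1991, Prop. 6.2 (1) / McCallum 1991, Lemma 4.3 at every finite `v ∤ m` for the CONCRETE
Kolyvagin classes AT `p = 3`, `hD` discharged** (x11b3-p2's `KolyvaginHloc.hloc_concrete_of_GZ31`
specialised to `p := 3`).  For `K` imaginary quadratic with `ι : K → ℂ`, `E = W/ℚ` globally minimal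
with a modular parametrisation `Dt` of level `N` prime to `d_K` (`hND`) and divisible by `3` (`h3`),
`M ≥ 1`, a square-free level `n` of Kolyvagin primes for `p = 3` with `Frob = Frob_∞` on `K(E[3^M])`
(`hKol`), ANY Kolyvagin–Heegner data `d m` at the divisors of `n`, and the LABELLED inputs `hGZ` =
[GZ86, III (3.1)] in the printed per-point form of the proof of Prop. 6.2 (cite-only, NOT a fact),
`hcop` (`n′` prime to `3^M`) and `hA` (Gross Lemma 4.3 / McCallum (5): `E(K[m]) ⊆ E(K̄)` admissible
for `3^M`): for all `m ∣ n` and every finite `v ∤ m`, `c_M(m) = (d m).kolyvaginClass ∈ Sel_v`.  The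
binder `hD : d_K < -4` of the general-`p` END is DISCHARGED from `hND` + `h3` + the orientation
`β² ≡ d_K (mod 4N)` carried by `d n` (`Three.discr_lt_neg_four_of_isCoprime_of_dvd_sq_sub`).  WORDING
OF RECORD: plumbing at concrete currency; CONDITIONAL on [GZ86 III (3.1)] (`hGZ`) + `hcop` + `hA` +
structural; `JET@p∣N` / (γ) / `h44` / `hpoints` / (A′-53) NOT discharged; nothing booked.
[cite: GrossLMS1991, §6 Prop. 6.2 (1) and proof, §1 (D ≠ 3, 4), Lemma 4.3, §4 (4.1)]
[cite: McCallumLMS1991, Lemma 4.3, §4 (4)–(6)] [cite: GrossZagier1986, III (3.1)] -/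
theorem hloc_concrete_at_three_of_GZ31 [NeZero N] [W.IsElliptic] [W.IsGloballyMinimal]
    (hK : IsImaginaryQuadratic K) (ι : K →+* ℂ) {M : ℕ} (hM : 1 ≤ M)
    (Dt : ModularParametrizationData W N) {β : ℤ}
    (hND : IsCoprime (N : ℤ) (NumberField.discr K)) (h3 : 3 ∣ N)
    {n : ℕ} (hn : Squarefree n)
    (hKol : ∀ q ∈ n.primeFactors, IsKolyvaginPrime N W K 3 q ∧ FrobEqFrobInfty W K (3 ^ M) q)
    (d : (m : ℕ) → m ∣ n → KolyvaginHeegnerData Dt β ι m)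
    {n' : ℤ} (hcop : IsCoprime ((3 ^ M : ℕ) : ℤ) n')
    (hGZ : ∀ (m : ℕ) (hm : m ∣ n) (γ : ringClassField K ι m ≃ₐ[ℚ] ringClassField K ι m),
      γ ∈ ringClassGal ι m → ∀ v : HeightOneSpectrum (𝓞 K), ¬ (W.baseChange K).HasGoodReductionAt v →
        n' • pointsMap (W.baseChange K) (v.adicCompletion K)
            ((d m hm).toGeomPoints (pointGalHom W (ringClassField K ι m) γ (d m hm).y)) ∈
          E0Receptacle (W.baseChange K) v ∧
        ∀ (ℓ : ℕ) (hℓ : ℓ ∈ m.primeFactors)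
          (hle : ringClassField K ι (m / ℓ) ≤ ringClassField K ι m),
          n' • pointsMap (W.baseChange K) (v.adicCompletion K)
              ((d m hm).toGeomPoints (pointGalHom W (ringClassField K ι m) γ
                (WeierstrassCurve.Affine.Point.map (W' := W)
                  ((RingClassField.inclusion ι hle).restrictScalars ℚ)
                  (d (m / ℓ) ((Nat.div_dvd_of_dvd (Nat.dvd_of_mem_primeFactors hℓ)).trans hm)).y))) ∈
            E0Receptacle (W.baseChange K) v)
    (hA : ∀ (m : ℕ) (hm : m ∣ n),
      IsAdmissible (absoluteGaloisGroup K) (d m hm).pointsSubgroup ((3 ^ M : ℕ) : ℤ)) :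
    ∀ (m : ℕ) (hm : m ∣ n) (v : HeightOneSpectrum (𝓞 K)), (m : 𝓞 K) ∉ v.asIdeal →
      (d m hm).kolyvaginClass Nat.prime_three M ∈
        selmerLocalKer (W.baseChange K) (v.adicCompletion K) ((3 ^ M : ℕ) : ℤ) :=
  KolyvaginHloc.hloc_concrete_of_GZ31 hK ι Nat.prime_three hM Dt hND
    (discr_lt_neg_four_of_isCoprime_of_dvd_sq_sub hK hND h3 (d n dvd_rfl).dvd_sq_sub) hn hKol d
    hcop hGZ hA

/-- **The concrete `hloc` clause at `p = 3` ON THE SURJECTIVE CELL: `hD` discharged, `hA` supplied**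
from the class-record binder `Surj W 3` (`ρ̄_{E,3}` onto `GL₂(𝔽₃)`) by x11b3-p3's
`RingClassNoTorsion.isAdmissible_pointsSubgroup_of_dvd` (`X11b/RingClassFieldNoTorsion`: Gross
Lemma 4.3 / McCallum (5) at the ring class fields `K[m]`, `m ∣ n`).  Remaining labelled binders EXACTLY
{`hGZ`} + `hcop` + the class binder `Surj W 3`; WORDING OF RECORD as above; nothing booked.
[cite: GrossLMS1991, Prop. 6.2 (1), Lemma 4.3, §4 (4.1)–(4.2)] [cite: McCallumLMS1991, Lemma 4.3, §4 (5)]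
[cite: GrossZagier1986, III (3.1)] -/
theorem hloc_concrete_at_three_of_GZ31_of_surj_three [NeZero N] [W.IsElliptic] [W.IsGloballyMinimal]
    (hK : IsImaginaryQuadratic K) (ι : K →+* ℂ) {M : ℕ} (hM : 1 ≤ M)
    (Dt : ModularParametrizationData W N) {β : ℤ}
    (hND : IsCoprime (N : ℤ) (NumberField.discr K)) (h3 : 3 ∣ N)
    {n : ℕ} (hn : Squarefree n)
    (hKol : ∀ q ∈ n.primeFactors, IsKolyvaginPrime N W K 3 q ∧ FrobEqFrobInfty W K (3 ^ M) q)
    (d : (m : ℕ) → m ∣ n → KolyvaginHeegnerData Dt β ι m)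
    {n' : ℤ} (hcop : IsCoprime ((3 ^ M : ℕ) : ℤ) n')
    (hGZ : ∀ (m : ℕ) (hm : m ∣ n) (γ : ringClassField K ι m ≃ₐ[ℚ] ringClassField K ι m),
      γ ∈ ringClassGal ι m → ∀ v : HeightOneSpectrum (𝓞 K), ¬ (W.baseChange K).HasGoodReductionAt v →
        n' • pointsMap (W.baseChange K) (v.adicCompletion K)
            ((d m hm).toGeomPoints (pointGalHom W (ringClassField K ι m) γ (d m hm).y)) ∈
          E0Receptacle (W.baseChange K) v ∧
        ∀ (ℓ : ℕ) (hℓ : ℓ ∈ m.primeFactors)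
          (hle : ringClassField K ι (m / ℓ) ≤ ringClassField K ι m),
          n' • pointsMap (W.baseChange K) (v.adicCompletion K)
              ((d m hm).toGeomPoints (pointGalHom W (ringClassField K ι m) γ
                (WeierstrassCurve.Affine.Point.map (W' := W)
                  ((RingClassField.inclusion ι hle).restrictScalars ℚ)
                  (d (m / ℓ) ((Nat.div_dvd_of_dvd (Nat.dvd_of_mem_primeFactors hℓ)).trans hm)).y))) ∈
            E0Receptacle (W.baseChange K) v)
    (hsurj : Rank1Residual.Surj W 3) :
    ∀ (m : ℕ) (hm : m ∣ n) (v : HeightOneSpectrum (𝓞 K)), (m : 𝓞 K) ∉ v.asIdeal →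
      (d m hm).kolyvaginClass Nat.prime_three M ∈
        selmerLocalKer (W.baseChange K) (v.adicCompletion K) ((3 ^ M : ℕ) : ℤ) :=
  hloc_concrete_at_three_of_GZ31 hK ι hM Dt hND h3 hn hKol d hcop hGZ
    (fun m hm ↦ RingClassNoTorsion.isAdmissible_pointsSubgroup_of_dvd hK
      (Squarefree.ne_zero hn) d Nat.prime_three (by decide) hsurj M m hm)

/-- **The concrete `hloc` clause at `p = 3` ON THE IRREDUCIBLE CELL: `hD` discharged, `hA` supplied**
from the class-record binder `W.HasIrreducibleModPGaloisRep 3` (`E[3]` irreducible, surjective or not)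
by x11b3-p4's `NoTorsionIrr.isAdmissible_pointsSubgroup_of_hasIrreducibleModPGaloisRep_of_dvd`
(`X11b/RingClassFieldNoTorsionOfIrreducible`: Lemma 4.3 without surjectivity, from irreducibility +
the Weil pairing + `3` unramified in `K` + `3 ∤ n`), all three side inputs DISCHARGED here: the Weil
pairing is the tree's theorem `WeierstrassCurve.exists_weilPairing_holds` (Silverman AEC III.8.1);
`3 ∤ d_K` (`hND` + `h3`) makes `3` unramified in `K` (Dedekind; Mathlib
`NumberField.not_dvd_discr_iff_isUnramifiedIn`, re-based by `isUnramifiedIn_of_isUnramifiedIn_span`);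
Kolyvagin primes for `p = 3` are `≠ 3` (Gross (3.1)).  Remaining labelled binders EXACTLY {`hGZ`} +
`hcop` + the class binder `hirr`; WORDING OF RECORD as above; nothing booked.
[cite: GrossLMS1991, Prop. 6.2 (1), Lemma 4.3, §3 (3.1), §4 (4.1)–(4.2)]
[cite: McCallumLMS1991, Lemma 4.3, §4 (5)] [cite: GrossZagier1986, III (3.1)] -/
theorem hloc_concrete_at_three_of_GZ31_of_irreducible [NeZero N] [W.IsElliptic]
    [W.IsGloballyMinimal] (hK : IsImaginaryQuadratic K) (ι : K →+* ℂ) {M : ℕ} (hM : 1 ≤ M)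
    (Dt : ModularParametrizationData W N) {β : ℤ}
    (hND : IsCoprime (N : ℤ) (NumberField.discr K)) (h3 : 3 ∣ N)
    {n : ℕ} (hn : Squarefree n)
    (hKol : ∀ q ∈ n.primeFactors, IsKolyvaginPrime N W K 3 q ∧ FrobEqFrobInfty W K (3 ^ M) q)
    (d : (m : ℕ) → m ∣ n → KolyvaginHeegnerData Dt β ι m)
    {n' : ℤ} (hcop : IsCoprime ((3 ^ M : ℕ) : ℤ) n')
    (hGZ : ∀ (m : ℕ) (hm : m ∣ n) (γ : ringClassField K ι m ≃ₐ[ℚ] ringClassField K ι m),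
      γ ∈ ringClassGal ι m → ∀ v : HeightOneSpectrum (𝓞 K), ¬ (W.baseChange K).HasGoodReductionAt v →
        n' • pointsMap (W.baseChange K) (v.adicCompletion K)
            ((d m hm).toGeomPoints (pointGalHom W (ringClassField K ι m) γ (d m hm).y)) ∈
          E0Receptacle (W.baseChange K) v ∧
        ∀ (ℓ : ℕ) (hℓ : ℓ ∈ m.primeFactors)
          (hle : ringClassField K ι (m / ℓ) ≤ ringClassField K ι m),
          n' • pointsMap (W.baseChange K) (v.adicCompletion K)
              ((d m hm).toGeomPoints (pointGalHom W (ringClassField K ι m) γ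
                (WeierstrassCurve.Affine.Point.map (W' := W)
                  ((RingClassField.inclusion ι hle).restrictScalars ℚ)
                  (d (m / ℓ) ((Nat.div_dvd_of_dvd (Nat.dvd_of_mem_primeFactors hℓ)).trans hm)).y))) ∈
            E0Receptacle (W.baseChange K) v)
    (hirr : W.HasIrreducibleModPGaloisRep 3) :
    ∀ (m : ℕ) (hm : m ∣ n) (v : HeightOneSpectrum (𝓞 K)), (m : 𝓞 K) ∉ v.asIdeal →
      (d m hm).kolyvaginClass Nat.prime_three M ∈
        selmerLocalKer (W.baseChange K) (v.adicCompletion K) ((3 ^ M : ℕ) : ℤ) := by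
  have hn0 : n ≠ 0 := Squarefree.ne_zero hn
  -- the Weil pairing on `E[3]` exists (tree theorem, Silverman AEC III.8.1)
  have hW : W.exists_weilPairing 3 := WeierstrassCurve.exists_weilPairing_holds W 3
  -- `3 ∤ n`: every prime factor of `n` is a Kolyvagin prime for `p = 3`, hence `≠ 3` (Gross (3.1))
  have hpn : ¬ 3 ∣ n := fun h3n ↦
    (hKol 3 (Nat.mem_primeFactors.mpr ⟨Nat.prime_three, h3n, hn0⟩)).1.2.2.2.1 rfl
  -- `3 ∤ d_K` (`hND` + `h3`), so `3` is unramified in `K` (Dedekind's discriminant theorem)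
  have h3N : (3 : ℤ) ∣ (N : ℤ) := by exact_mod_cast h3
  have h3d : ¬ (3 : ℤ) ∣ NumberField.discr K := fun hd ↦ by
    have hu := hND.isUnit_of_dvd' h3N hd
    rw [Int.isUnit_iff] at hu
    omega
  have hKunr : ∀ v : HeightOneSpectrum (𝓞 ℚ), ((3 : ℕ) : 𝓞 ℚ) ∈ v.asIdeal →
      Algebra.IsUnramifiedIn (𝓞 K) v.asIdeal :=
    isUnramifiedIn_of_isUnramifiedIn_span Nat.prime_three
      ((NumberField.not_dvd_discr_iff_isUnramifiedIn K (𝓞 K)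
        (Nat.prime_iff_prime_int.mp Nat.prime_three)).mp (by exact_mod_cast h3d))
  exact hloc_concrete_at_three_of_GZ31 hK ι hM Dt hND h3 hn hKol d hcop hGZ
    (fun m hm ↦ NoTorsionIrr.isAdmissible_pointsSubgroup_of_hasIrreducibleModPGaloisRep_of_dvd hK
      hn0 d Nat.prime_three (by decide) hirr hW hKunr hpn M m hm)

end Summit.BirchSwinnertonDyer.Rank1Residual.X11b.Three

end
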